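import Summits.SmoothPoincare4.SmoothPoincare4.Theorems.ConvexBisectionAcyclicBisectionExistsBaseReflectionMap
import Summits.SmoothPoincare4.SmoothPoincare4.Theorems.ConvexBisectionAcyclicBisectionExistsPageTwistingTransverseLoop
import Literature.Topology.FourManifolds.RegularDomainMaps
import HarnessLib

/-!
# The fibred orientation-reversing involution of the Lefschetz base, III: the self-diffeomorphism
# `baseReflection g` of `Base g`
(wave 2, node "fibred orientation-reversing involution `σ` of `Base g`" of stub
`stub_steinRealisation` = NF6, line `modp-braid-orbits` r11, crux
`ConvexBisection.AcyclicBisectionExists`, item stmt-SmoothPoincare4-10508; registered sub-goal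
`helper_baseReflection_w`)

Sequel of `…BaseReflectionMap.lean`: the smooth ambient map `σ = baseReflectionAmb g` of `ℝ⁴`
preserves `rho` on the region `Re w > -5/8 ⊇ {rho ≤ 1/4}`, so it restricts to the base
`Base g = {rho ≤ 1/4}` (a regular sublevel set, `LefschetzBaseRegular.lean`); the restriction is
smooth for the manifold-with-boundary structure (`HalfSliceAtlas.contMDiff_codRestrict`, Lee
Cor. 5.30, as for `baseStageDiffeo` of `…PageRotationFlow.lean`) and is its own inverse:

* §5 `baseReflection g : Base g ≃ₘ⟮𝓡∂ 4, 𝓡∂ 4⟯ Base g`; it preserves `w` (`w_baseReflection`),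
  `rho`, `‖x‖`, is an involution (`baseReflection_baseReflection`, `baseReflection_symm`), maps
  every page `page g c` onto itself (`baseReflection_mem_page_iff`, `image_baseReflection_page`),
  the binding `{w = 0}` and the boundary `{rho = 1/4}` onto themselves
  (`helper_baseReflection_w` packages these);
* §6 the ambient reading of its differential: `ambient (σ x) (dσ_x v) = dσ^{amb}(ambient x v)`
  (chain rule on `incl ∘ σ = σ^{amb} ∘ incl`) and `(σ ∘ K)' = dσ^{amb}(K')` for the ambient
  velocity of a loop — the two inputs of the twisting computation of
  `…BaseReflectionTwisting.lean`.

Everything is proved; no named facts, no `sorry`.  References: J. M. Lee, *Introduction to Smooth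
Manifolds* (2013), Cor. 5.30 [LeeSmoothManifolds2013]; J. B. Etnyre, T. Fuller, *Realizing
4-manifolds as achiral Lefschetz fibrations*, IMRN 2006, §2 [EtnyreFuller2006].
-/

noncomputable section

set_option linter.dupNamespace false

open scoped Manifold ContDiff Topology ComplexConjugate
open Set Function Metric Complex
open Literature.Topology.FourManifolds Literature.Topology.FourManifolds.LefschetzBase

namespace Summit.SmoothPoincare4.SmoothPoincare4.Theorems.AcyclicBisectionExists.ModpBraidOrbits

variable {g : ℕ}

/-! ## §5 The fibred reflection of the base -/

/-- `σ` maps `{rho ≤ 1/4}` to itself. [folklore] -/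
theorem rho_baseReflectionAmb_le (q : Base g) : rho g (baseReflectionAmb g q.1) ≤ 1 / 4 := by
  rw [rho_baseReflectionAmb (mem_reflRegion_of_rho_le q.2)]; exact q.2

/-- The restriction of `σ` to the base, as a map. [folklore] -/
def baseReflectionFun (g : ℕ) (q : Base g) : Base g :=
  ⟨baseReflectionAmb g q.1, rho_baseReflectionAmb_le q⟩

/-- The restriction of `σ` to the base is smooth for the manifold-with-boundary structure of the
base (smooth maps into a regular domain: `HalfSliceAtlas.contMDiff_codRestrict`).
[cite: LeeSmoothManifolds2013, Cor. 5.30] -/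
theorem contMDiff_baseReflectionFun (g : ℕ) : ContMDiff (𝓡∂ 4) (𝓡∂ 4) ∞ (baseReflectionFun g) :=
  (RegularSublevel.halfSliceAtlas (isRegularLevel_rho g)).contMDiff_codRestrict
    (fun q : Base g => rho_baseReflectionAmb_le q)
    ((contDiff_baseReflectionAmb g).contMDiff.comp (RegularSublevel.contMDiff_incl (isRegularLevel_rho g)))

/-- The restriction of `σ` to the base is an involution. [folklore] -/
theorem baseReflectionFun_baseReflectionFun (q : Base g) :
    baseReflectionFun g (baseReflectionFun g q) = q :=
  Subtype.ext (baseReflectionAmb_baseReflectionAmb (mem_reflRegion_of_rho_le q.2))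

/-- **The fibred orientation-reversing involution of the Lefschetz base** `Base g`:
`σ(x, y) = (λ(w) x̄, μ(w) ȳ)` restricted to `{rho ≤ 1/4}`, a self-diffeomorphism (its own inverse)
of the compact manifold with boundary `Base g`. [folklore] -/
def baseReflection (g : ℕ) : Base g ≃ₘ⟮𝓡∂ 4, 𝓡∂ 4⟯ Base g where
  toFun := baseReflectionFun g
  invFun := baseReflectionFun g
  left_inv := baseReflectionFun_baseReflectionFun
  right_inv := baseReflectionFun_baseReflectionFun
  contMDiff_toFun := contMDiff_baseReflectionFun g
  contMDiff_invFun := contMDiff_baseReflectionFun g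

/-- The fibred reflection, read in `ℝ⁴`. [folklore] -/
@[simp] theorem coe_baseReflection (q : Base g) : (baseReflection g q).1 = baseReflectionAmb g q.1 := rfl

/-- **`σ` preserves `w`** (hence the fibration by pages and the binding). [folklore] -/
theorem w_baseReflection (q : Base g) : w g (baseReflection g q).1 = w g q.1 :=
  w_baseReflectionAmb (mem_reflRegion_of_rho_le q.2)

/-- **`σ` preserves `rho`.** [folklore] -/
theorem rho_baseReflection (q : Base g) : rho g (baseReflection g q).1 = rho g q.1 :=
  rho_baseReflectionAmb (mem_reflRegion_of_rho_le q.2)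

/-- `σ` preserves `‖x‖`. [folklore] -/
theorem norm_cx_baseReflection (q : Base g) : ‖cx (baseReflection g q).1‖ = ‖cx q.1‖ :=
  norm_cx_baseReflectionAmb q.1

/-- **`σ` is an involution.** [folklore] -/
@[simp] theorem baseReflection_baseReflection (q : Base g) :
    baseReflection g (baseReflection g q) = q :=
  baseReflectionFun_baseReflectionFun q

/-- `σ` is an involution. [folklore] -/
theorem involutive_baseReflection (g : ℕ) : Function.Involutive (baseReflection g) :=
  baseReflection_baseReflection

/-- `σ` is its own inverse. [folklore] -/
theorem baseReflection_symm (g : ℕ) : (baseReflection g).symm = baseReflection g := rfl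

/-- **`σ` maps each page onto itself** (`‖x‖` and `w` are preserved). [folklore] -/
theorem baseReflection_mem_page_iff {c : ℂ} (q : Base g) :
    baseReflection g q ∈ page g c ↔ q ∈ page g c := by
  simp only [page, mem_setOf_eq, w_baseReflection, norm_cx_baseReflection]

/-- `σ` maps each page onto itself. [folklore] -/
theorem image_baseReflection_page (c : ℂ) : baseReflection g '' page g c = page g c := by
  ext q
  constructor
  · rintro ⟨q', hq', rfl⟩; exact (baseReflection_mem_page_iff q').2 hq'
  · intro hq
    exact ⟨baseReflection g q, (baseReflection_mem_page_iff q).2 hq, baseReflection_baseReflection q⟩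

/-- **`σ` preserves the binding `{w = 0}`.** [folklore] -/
theorem w_baseReflection_eq_zero_iff (q : Base g) : w g (baseReflection g q).1 = 0 ↔ w g q.1 = 0 := by
  rw [w_baseReflection]

/-- **`σ` preserves the boundary `{rho = 1/4}`.** [folklore] -/
theorem baseReflection_mem_boundary_iff (q : Base g) :
    baseReflection g q ∈ (𝓡∂ 4).boundary (Base g) ↔ q ∈ (𝓡∂ 4).boundary (Base g) := by
  rw [RegularSublevel.mem_boundary_iff (isRegularLevel_rho g), RegularSublevel.mem_boundary_iff
    (isRegularLevel_rho g)]
  exact Iff.of_eq (congrArg (· = (1 / 4 : ℝ)) (rho_baseReflection q))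

/-- **Sub-goal `helper_baseReflection_w`** (NF6, node "fibred orientation-reversing involution of
the base", lead c5 wave 2): the fibred reflection `σ = baseReflection g` of `Base g` preserves
`w = y² − x^{2g+1} − 1` and `rho`, is an involution, maps every page `page g c` onto itself and the
boundary onto itself. [folklore] -/
theorem helper_baseReflection_w : ∀ (g : ℕ)
    (q : Literature.Topology.FourManifolds.LefschetzBase.Base g),
    Literature.Topology.FourManifolds.LefschetzBase.w g
        (Summit.SmoothPoincare4.SmoothPoincare4.Theorems.AcyclicBisectionExists.ModpBraidOrbits.baseReflection g q).1 =
      Literature.Topology.FourManifolds.LefschetzBase.w g q.1 ∧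
    Literature.Topology.FourManifolds.LefschetzBase.rho g
        (Summit.SmoothPoincare4.SmoothPoincare4.Theorems.AcyclicBisectionExists.ModpBraidOrbits.baseReflection g q).1 =
      Literature.Topology.FourManifolds.LefschetzBase.rho g q.1 ∧
    Summit.SmoothPoincare4.SmoothPoincare4.Theorems.AcyclicBisectionExists.ModpBraidOrbits.baseReflection g
        (Summit.SmoothPoincare4.SmoothPoincare4.Theorems.AcyclicBisectionExists.ModpBraidOrbits.baseReflection g q) = q ∧
    (∀ c : ℂ, Summit.SmoothPoincare4.SmoothPoincare4.Theorems.AcyclicBisectionExists.ModpBraidOrbits.baseReflection g q ∈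
        Literature.Topology.FourManifolds.LefschetzBase.page g c ↔
      q ∈ Literature.Topology.FourManifolds.LefschetzBase.page g c) ∧
    (Summit.SmoothPoincare4.SmoothPoincare4.Theorems.AcyclicBisectionExists.ModpBraidOrbits.baseReflection g q ∈
        (𝓡∂ 4).boundary (Literature.Topology.FourManifolds.LefschetzBase.Base g) ↔
      q ∈ (𝓡∂ 4).boundary (Literature.Topology.FourManifolds.LefschetzBase.Base g)) :=
  fun _ q => ⟨w_baseReflection q, rho_baseReflection q, baseReflection_baseReflection q,
    fun _ => baseReflection_mem_page_iff q, baseReflection_mem_boundary_iff q⟩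

/-! ## §6 The differential of `σ` on ambient vectors -/

/-- **The ambient reading of `dσ`**: `ambient (σ x) (dσ_x v) = dσ^{amb}_{x} (ambient x v)`
(chain rule on `incl ∘ σ = σ^{amb} ∘ incl`). [folklore] -/
theorem ambient_mfderiv_baseReflection (x : Base g) (v : EuclideanSpace ℝ (Fin 4)) :
    ambient g (baseReflection g x) (mfderiv (𝓡∂ 4) (𝓡∂ 4) (baseReflection g) x v) =
      fderiv ℝ (baseReflectionAmb g) x.1 (ambient g x v) := by
  have hσ : MDifferentiableAt (𝓡∂ 4) (𝓡∂ 4) (baseReflection g) x :=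
    (baseReflection g).contMDiff.mdifferentiableAt (by simp)
  have hincl : ∀ y : Base g,
      MDifferentiableAt (𝓡∂ 4) (𝓡 4) (RegularSublevel.incl (isRegularLevel_rho g)) y := fun y =>
    (RegularSublevel.contMDiff_incl _).mdifferentiableAt (by simp)
  have hA : MDifferentiableAt (𝓡 4) (𝓡 4) (baseReflectionAmb g) x.1 :=
    mdifferentiableAt_iff_differentiableAt.2 ((contDiff_baseReflectionAmb g).differentiable (by simp) _)
  have h1 := mfderiv_comp x (hincl (baseReflection g x)) hσ
  have h2 := mfderiv_comp x (f := RegularSublevel.incl (isRegularLevel_rho g))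
    (g := baseReflectionAmb g) hA (hincl x)
  have h3 : (mfderiv (𝓡∂ 4) (𝓡 4) (RegularSublevel.incl (isRegularLevel_rho g))
      (baseReflection g x)).comp (mfderiv (𝓡∂ 4) (𝓡∂ 4) (baseReflection g) x) =
      (mfderiv (𝓡 4) (𝓡 4) (baseReflectionAmb g) x.1).comp
        (mfderiv (𝓡∂ 4) (𝓡 4) (RegularSublevel.incl (isRegularLevel_rho g)) x) :=
    h1.symm.trans h2
  have h := congrArg (fun L => L v) h3
  simp only [ContinuousLinearMap.comp_apply] at h
  rw [← mfderiv_eq_fderiv]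
  exact h

/-- **The ambient velocity of the reflected loop**: `(σ ∘ K)' = dσ^{amb}(K')`. [folklore] -/
theorem deriv_ambCurve_baseReflection_comp {K : sphere (0 : EuclideanSpace ℝ (Fin 2)) 1 → Base g}
    {t : ℝ} (hK : MDifferentiableAt (𝓡 1) (𝓡∂ 4) K (circlePt t)) :
    deriv (ambCurve g (baseReflection g ∘ K)) t =
      fderiv ℝ (baseReflectionAmb g) (ambCurve g K t) (deriv (ambCurve g K) t) := by
  have e : ambCurve g (baseReflection g ∘ K) = baseReflectionAmb g ∘ ambCurve g K := rfl
  rw [e]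
  exact fderiv_comp_deriv t ((contDiff_baseReflectionAmb g).differentiable (by simp) _)
    (hasDerivAt_ambCurve hK).differentiableAt

end Summit.SmoothPoincare4.SmoothPoincare4.Theorems.AcyclicBisectionExists.ModpBraidOrbits

end
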